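import Literature.Analysis.ODE.CodeListMeanValueExtension
import HarnessLib

/-!
# Constant-folding code lists for the flow Taylor coefficients and their Jacobians

Trunk T-ANA (Analysis/ODE); namespace `Literature.Analysis.ODE`.

`ElementaryFieldVariationalCertificate.lean` generates the code lists `taylorExpr F j i` of the flow
Taylor coefficient maps by the Lie–Taylor recursion `Φ_{j+1} = (1/(j+1)) ∑_l f_l ∂_l Φⱼ` (Moore 1979
(3.15)) from the derived code lists `pderiv l` (Moore 1979 (4.21)).  Written out WITHOUT
simplification the derived code list of a product doubles the tree and a constant subtree keeps its
zero derivative, so `pderiv l (taylorExpr F j i)` grows like `(2n)ʲ·|f|` (swing equation, order 6: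
`2.2·10⁷` tree nodes for the `28` Jacobian code lists of one step; their interval evaluation is the
bulk of the kernel replay of a `C¹`-Lohner step).  This file is Moore's remark that the recursion
rules simplify for constant operands — "if u is a constant (independent of t), then
(uv)_k = u(v)_k because (u)_j = 0 for j ≥ 1" (1979 §3.4, p. 27 after (3.19); also p. 28 after
(3.22)) — carried out on the code lists, with the proof that the denoted real functions do not
change:

* §1 smart constructors `sAdd`, `sSub`, `sNeg`, `sSmul`, `sMul` (exact rational folding, `0 + e = e`,
  `0 · e = 0`, `1 · e = e`, `q • (p • e) = (qp) • e`): same TOTAL real function as the plain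
  constructor (`eval_sAdd`, …, unconditionally), defined wherever the operands are (`dom_sAdd`, …);
* §2 `pderivS k e`: `eval_pderivS : ⟦pderivS k e⟧ = ⟦pderiv k e⟧` everywhere, `dom_pderivS`;
* the constant-folded Lie–Taylor recursion `taylorExprS`, its meaning `⟦taylorExprS F j i⟧ = (Φⱼ)ᵢ`
  on `Ω` and the fast `C¹` step / doubleton chain checkers built on it are
  `ElementaryFieldVariationalCertificateFast.lean` and
  `ElementaryFieldDoubletonChainCertificateFast.lean` (swing equation, order 6: `9.3·10³` tree
  nodes for the `28` Jacobian code lists instead of `2.2·10⁷`).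

Honest limits.  Exact constant folding and the unit/zero laws only (no common subexpressions, no
polynomial normal form).  The folded code lists denote the same functions but are DIFFERENT code
lists: their interval evaluations are not comparable with those of `taylorExpr`/`pderiv` in either
direction — hence a separate checker with its own soundness theorem, not a lemma about the old one.

## References

* R. E. Moore, *Methods and Applications of Interval Analysis*, SIAM 1979: §3.4 eqs. (3.13)–(3.19),
  the note after (3.19), procedure steps 1–4; §4.3 eq. (4.21). [held: lit key
  book:moorend-methods-applications-interval-analysis, pp. 24–27, 42–45] [Moore1979]
* A. Griewank, A. Walther, *Evaluating Derivatives*, 2nd ed., SIAM 2008, §3.1 (forward mode; the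
  tangent code omits zero tangents). [GriewankWalther2008]
-/

noncomputable section

open Literature.Analysis.ValidatedNumerics Literature.Analysis.ValidatedNumerics.ITaylor

namespace Literature.Analysis.ODE

namespace FExpr

variable {n : ℕ}

/-! ### §1. Constant-folding smart constructors -/

/-- The rational constant a code list IS, if it is the one-line code list `const q`.
[cite: Moore1979, §3.4 (note after eq. (3.19))] -/
def asConst : FExpr n → Option ℚ
  | const q => some q
  | _ => none

/-- `asConst` answers `q` exactly on the code list `const q`. [folklore] -/
private theorem asConst_eq_some_iff {e : FExpr n} {q : ℚ} : e.asConst = some q ↔ e = const q := by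
  cases e <;> simp [asConst]

/-- **Sum with constant folding**: `p + q` folded, `0 + e = e`, `e + 0 = e`.
[cite: Moore1979, §3.4 (note after eq. (3.19))] -/
def sAdd (a b : FExpr n) : FExpr n :=
  match a.asConst, b.asConst with
  | some p, some q => const (p + q)
  | some p, none => if p = 0 then b else add a b
  | none, some q => if q = 0 then a else add a b
  | none, none => add a b

/-- **Difference with constant folding**: `p − q` folded, `e − 0 = e`, `0 − e = −e`.
[cite: Moore1979, §3.4 (note after eq. (3.19))] -/
def sSub (a b : FExpr n) : FExpr n :=
  match a.asConst, b.asConst with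
  | some p, some q => const (p - q)
  | some p, none => if p = 0 then neg b else sub a b
  | none, some q => if q = 0 then a else sub a b
  | none, none => sub a b

/-- **Negation with constant folding**: `−q` folded. [cite: Moore1979, §3.4 (note after eq. (3.19))] -/
def sNeg (a : FExpr n) : FExpr n :=
  match a.asConst with
  | some p => const (-p)
  | none => neg a

/-- **Rational scalar with constant folding**: `q · p` folded, `0 • e = 0`, `1 • e = e`,
`q • (p • e) = (qp) • e`. [cite: Moore1979, §3.4 (note after eq. (3.19))] -/
def sSmul (q : ℚ) (a : FExpr n) : FExpr n :=
  match a.asConst with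
  | some p => const (q * p)
  | none =>
    if q = 0 then const 0 else if q = 1 then a else
      match a with
      | smul p b => smul (q * p) b
      | _ => smul q a

/-- **Product with constant folding**: a constant factor becomes a rational scalar (and is then
folded by `sSmul`: `0 · e = 0`, `1 · e = e`). [cite: Moore1979, §3.4 (note after eq. (3.19))]
[cite: GriewankWalther2008, §3.1] -/
def sMul (a b : FExpr n) : FExpr n :=
  match a.asConst, b.asConst with
  | some p, _ => sSmul p b
  | none, some q => sSmul q a
  | none, none => mul a b

variable (x : Fin n → ℝ)

/-- `sAdd` denotes the sum (total real functions). [cite: Moore1979, §3.4 (note after eq. (3.19))] -/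
theorem eval_sAdd (a b : FExpr n) : (sAdd a b).eval x = a.eval x + b.eval x := by
  unfold sAdd
  rcases ha : a.asConst with _ | p <;> rcases hb : b.asConst with _ | q
  · rfl
  · obtain rfl := asConst_eq_some_iff.1 hb
    dsimp only
    split_ifs with h
    · subst h; simp [eval]
    · rfl
  · obtain rfl := asConst_eq_some_iff.1 ha
    dsimp only
    split_ifs with h
    · subst h; simp [eval]
    · rfl
  · obtain rfl := asConst_eq_some_iff.1 ha
    obtain rfl := asConst_eq_some_iff.1 hb
    simp [eval]

/-- `sSub` denotes the difference. [cite: Moore1979, §3.4 (note after eq. (3.19))] -/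
theorem eval_sSub (a b : FExpr n) : (sSub a b).eval x = a.eval x - b.eval x := by
  unfold sSub
  rcases ha : a.asConst with _ | p <;> rcases hb : b.asConst with _ | q
  · rfl
  · obtain rfl := asConst_eq_some_iff.1 hb
    dsimp only
    split_ifs with h
    · subst h; simp [eval]
    · rfl
  · obtain rfl := asConst_eq_some_iff.1 ha
    dsimp only
    split_ifs with h
    · subst h; simp [eval]
    · rfl
  · obtain rfl := asConst_eq_some_iff.1 ha
    obtain rfl := asConst_eq_some_iff.1 hb
    simp [eval]

/-- `sNeg` denotes the negation. [cite: Moore1979, §3.4 (note after eq. (3.19))] -/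
theorem eval_sNeg (a : FExpr n) : (sNeg a).eval x = -a.eval x := by
  unfold sNeg
  rcases ha : a.asConst with _ | p
  · rfl
  · obtain rfl := asConst_eq_some_iff.1 ha
    simp [eval]

/-- `sSmul` denotes the rational scalar multiple. [cite: Moore1979, §3.4 (note after eq. (3.19))] -/
theorem eval_sSmul (q : ℚ) (a : FExpr n) : (sSmul q a).eval x = (q : ℝ) * a.eval x := by
  unfold sSmul
  rcases ha : a.asConst with _ | p
  · dsimp only
    split_ifs with h0 h1
    · subst h0; simp [eval]
    · subst h1; simp
    · cases a <;> simp [eval, mul_assoc]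
  · obtain rfl := asConst_eq_some_iff.1 ha
    simp [eval]

/-- `sMul` denotes the product. [cite: Moore1979, §3.4 (note after eq. (3.19))] -/
theorem eval_sMul (a b : FExpr n) : (sMul a b).eval x = a.eval x * b.eval x := by
  unfold sMul
  rcases ha : a.asConst with _ | p <;> rcases hb : b.asConst with _ | q
  · rfl
  · obtain rfl := asConst_eq_some_iff.1 hb
    rw [eval_sSmul, eval, mul_comm]
  · obtain rfl := asConst_eq_some_iff.1 ha
    rw [eval_sSmul, eval]
  · obtain rfl := asConst_eq_some_iff.1 ha
    rw [eval_sSmul, eval]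

variable {x}

/-- `sAdd` is defined where its operands are. [cite: Moore1979, §3.4 (note after eq. (3.19))] -/
theorem dom_sAdd {a b : FExpr n} (ha : a.dom x) (hb : b.dom x) : (sAdd a b).dom x := by
  unfold sAdd
  rcases a.asConst with _ | p <;> rcases b.asConst with _ | q
  · exact ⟨ha, hb⟩
  · dsimp only; split_ifs
    · exact ha
    · exact ⟨ha, hb⟩
  · dsimp only; split_ifs
    · exact hb
    · exact ⟨ha, hb⟩
  · trivial

/-- `sSub` is defined where its operands are. [cite: Moore1979, §3.4 (note after eq. (3.19))] -/
theorem dom_sSub {a b : FExpr n} (ha : a.dom x) (hb : b.dom x) : (sSub a b).dom x := by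
  unfold sSub
  rcases a.asConst with _ | p <;> rcases b.asConst with _ | q
  · exact ⟨ha, hb⟩
  · dsimp only; split_ifs
    · exact ha
    · exact ⟨ha, hb⟩
  · dsimp only; split_ifs
    · exact hb
    · exact ⟨ha, hb⟩
  · trivial

/-- `sNeg` is defined where its operand is. [cite: Moore1979, §3.4 (note after eq. (3.19))] -/
theorem dom_sNeg {a : FExpr n} (ha : a.dom x) : (sNeg a).dom x := by
  unfold sNeg
  rcases a.asConst with _ | p
  · exact ha
  · trivial

/-- `sSmul` is defined where its operand is. [cite: Moore1979, §3.4 (note after eq. (3.19))] -/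
theorem dom_sSmul (q : ℚ) {a : FExpr n} (ha : a.dom x) : (sSmul q a).dom x := by
  unfold sSmul
  rcases a.asConst with _ | p
  · dsimp only
    split_ifs
    · trivial
    · exact ha
    · cases a <;> exact ha
  · trivial

/-- `sMul` is defined where its operands are. [cite: Moore1979, §3.4 (note after eq. (3.19))] -/
theorem dom_sMul {a b : FExpr n} (ha : a.dom x) (hb : b.dom x) : (sMul a b).dom x := by
  unfold sMul
  rcases a.asConst with _ | p <;> rcases b.asConst with _ | q
  · exact ⟨ha, hb⟩
  · exact dom_sSmul q ha
  · exact dom_sSmul p hb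
  · exact dom_sSmul p hb

/-! ### §2. The constant-folded derived code list of a partial derivative -/

/-- **The code list of `∂e/∂x_k` with constant folding**: Moore's (4.21) line by line as in
`pderiv`, every sum / product / scalar formed with the smart constructors of §1, so the zero
derivatives of constants and of the other variables are absorbed where they arise.
[cite: Moore1979, §4.3 eq. (4.21)] [cite: Moore1979, §3.4 (note after eq. (3.19))] -/
def pderivS (k : Fin n) : FExpr n → FExpr n
  | var i => const (if i = k then 1 else 0)
  | const _ => const 0
  | add a b => sAdd (pderivS k a) (pderivS k b)
  | sub a b => sSub (pderivS k a) (pderivS k b)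
  | neg a => sNeg (pderivS k a)
  | smul q a => sSmul q (pderivS k a)
  | mul a b => sAdd (sMul (pderivS k a) b) (sMul a (pderivS k b))
  | pow a m => sSmul (m : ℚ) (sMul (pow a (m - 1)) (pderivS k a))
  | exp a => sMul (exp a) (pderivS k a)
  | log a => div (pderivS k a) a
  | sin a => sMul (cos a) (pderivS k a)
  | cos a => sNeg (sMul (sin a) (pderivS k a))
  | inv a => sNeg (div (pderivS k a) (mul a a))
  | div a b => div (sSub (sMul (pderivS k a) b) (sMul a (pderivS k b))) (mul b b)
  | sqrt a => div (pderivS k a) (smul 2 (sqrt a))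

/-- **The constant-folded derived code list denotes the same function as the plain one**,
everywhere (total real functions on both sides). [cite: Moore1979, §4.3 eq. (4.21)]
[cite: Moore1979, §3.4 (note after eq. (3.19))] -/
theorem eval_pderivS (k : Fin n) (x : Fin n → ℝ) :
    ∀ e : FExpr n, (pderivS k e).eval x = (pderiv k e).eval x := by
  intro e
  induction e with
  | var i => rfl
  | const q => rfl
  | add a b iha ihb => simp only [pderivS, pderiv, eval, eval_sAdd, iha, ihb]
  | sub a b iha ihb => simp only [pderivS, pderiv, eval, eval_sSub, iha, ihb]
  | neg a ih => simp only [pderivS, pderiv, eval, eval_sNeg, ih]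
  | smul q a ih => simp only [pderivS, pderiv, eval, eval_sSmul, ih]
  | mul a b iha ihb => simp only [pderivS, pderiv, eval, eval_sAdd, eval_sMul, iha, ihb]
  | pow a m ih => simp only [pderivS, pderiv, eval, eval_sSmul, eval_sMul, ih]
  | exp a ih => simp only [pderivS, pderiv, eval, eval_sMul, ih]
  | log a ih => simp only [pderivS, pderiv, eval, ih]
  | sin a ih => simp only [pderivS, pderiv, eval, eval_sMul, ih]
  | cos a ih => simp only [pderivS, pderiv, eval, eval_sNeg, eval_sMul, ih]
  | inv a ih => simp only [pderivS, pderiv, eval, eval_sNeg, ih]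
  | div a b iha ihb => simp only [pderivS, pderiv, eval, eval_sSub, eval_sMul, iha, ihb]
  | sqrt a ih => simp only [pderivS, pderiv, eval, ih]

/-- The constant-folded derived code list is defined wherever `e` is.
[cite: Moore1979, §4.3 eq. (4.21)] -/
theorem dom_pderivS (k : Fin n) {x : Fin n → ℝ} :
    ∀ e : FExpr n, e.dom x → (pderivS k e).dom x := by
  intro e
  induction e with
  | var i => intro _; trivial
  | const q => intro _; trivial
  | add a b iha ihb => intro h; exact dom_sAdd (iha h.1) (ihb h.2)
  | sub a b iha ihb => intro h; exact dom_sSub (iha h.1) (ihb h.2)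
  | neg a ih => intro h; exact dom_sNeg (ih h)
  | smul q a ih => intro h; exact dom_sSmul q (ih h)
  | mul a b iha ihb => intro h; exact dom_sAdd (dom_sMul (iha h.1) h.2) (dom_sMul h.1 (ihb h.2))
  | pow a m ih => intro h; exact dom_sSmul _ (dom_sMul h (ih h))
  | exp a ih => intro h; exact dom_sMul h (ih h)
  | log a ih =>
    intro h
    exact ⟨ih h.1, h.1, (h : a.dom x ∧ 0 < a.eval x).2.ne'⟩
  | sin a ih => intro h; exact dom_sMul h (ih h)
  | cos a ih => intro h; exact dom_sNeg (dom_sMul h (ih h))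
  | inv a ih =>
    intro h
    have h' : a.dom x ∧ a.eval x ≠ 0 := h
    exact dom_sNeg ⟨ih h'.1, ⟨h'.1, h'.1⟩, mul_ne_zero h'.2 h'.2⟩
  | div a b iha ihb =>
    intro h
    have h' : a.dom x ∧ (b.dom x ∧ b.eval x ≠ 0) := h
    exact ⟨dom_sSub (dom_sMul (iha h'.1) h'.2.1) (dom_sMul h'.1 (ihb h'.2.1)), ⟨h'.2.1, h'.2.1⟩,
      mul_ne_zero h'.2.2 h'.2.2⟩
  | sqrt a ih =>
    intro h
    have h' : a.dom x ∧ 0 < a.eval x := h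
    refine ⟨ih h'.1, h', ?_⟩
    show ((2 : ℚ) : ℝ) * Real.sqrt (a.eval x) ≠ 0
    exact mul_ne_zero (by norm_num) (Real.sqrt_pos.mpr h'.2).ne'

end FExpr

end Literature.Analysis.ODE
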